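import Mathlib
import HarnessLib
import Literature.MathematicalPhysics.KineticTheory.FouriersLaw
import Literature.MathematicalPhysics.KineticTheory.LangevinChainGibbs
import Literature.MathematicalPhysics.KineticTheory.LangevinChainKernel
import Summits.AtomisticToContinuum.FouriersLaw.Theses.PuiseuxTransferLedger

/-!
# Sketch — crux-ideate stmt-AtomisticToContinuum-12111 (`PuiseuxTransferLedger.TwoModeBulk`), ideator 1, round 1

First-lemma signatures for two crux idea cards (they only need to ELABORATE; nothing is proved here):

* Card `umklapp-balance-normal-bulk` — the exact current-balance identity
  `L j_x = ½(Φ_x − Φ_{x+1}) − ½ Ξ_x` (interior bonds) for `pinnedChain`, its stationary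
  consequence, the exact finite-`δ` response-of-coboundary identity, and the transfer
  `UmklappOhm ∧ ThermometerLock ∧ ContactRows → TwoModeBulk`.
* Card `screened-precision-wiener-hopf` — the kinetic kernel `K_N`, its killing identity,
  the far-bath-column form of the profile, the palindromic-recurrence mode lemma, and the transfer
  `ExpScreenedPrecision ∧ NoUnimodularRoot → TwoModeBulk`.
-/

noncomputable section

open MeasureTheory Filter Topology
open scoped BigOperators

namespace Summit.AtomisticToContinuum.FouriersLaw.Cruxes.TwoModeBulk.Ideator1

open Literature.MathematicalPhysics.KineticTheory.HeatConduction

/-! ## Card U — umklapp balance -/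

/-- `U'(q) = ω₂ q + lam q³` for `pinnedChain`. -/
def dU (ω₂ lam q : ℝ) : ℝ := ω₂ * q + lam * q ^ 3

/-- `U(q) = ω₂ q²/2 + lam q⁴/4`. -/
def potU (ω₂ lam q : ℝ) : ℝ := ω₂ * q ^ 2 / 2 + lam * q ^ 4 / 4

/-- `V'(r) = r + β r³`. -/
def dV (β r : ℝ) : ℝ := r + β * r ^ 3

/-- The FLUX OF ENERGY CURRENT ("phonon-gas momentum flux") at site `i`:
`Φ_i = p_i² − 2U(q_i) + V'(r_i)·V'(r_{i-1})` (`r_i = q_{i+1} − q_i`; a missing bond contributes `0`,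
as in the tree's `bondCurrent`). At `lam = β = 0` this is the density whose discrete gradient is
`2·{H, j_i}`: the harmonic energy current is a conserved quantity bond by bond. -/
def fluxPhi (ω₂ lam β : ℝ) (N : ℕ) (i : Fin N) (z : PhaseSpace N) : ℝ :=
  z.2 i ^ 2 - 2 * potU ω₂ lam (z.1 i)
    + (∑ j : Fin N, if j.val = i.val + 1 then dV β (z.1 j - z.1 i) else 0)
      * (∑ k : Fin N, if i.val = k.val + 1 then dV β (z.1 i - z.1 k) else 0)

/-- The UMKLAPP DENSITY of the bond `(i, j)`, `j = i + 1`, `r = q_j − q_i`: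
`Ξ = −3β r²(p_i² − p_j²) − 2β r²(U(q_j) − U(q_i)) − (lam/2)(1 + β r²) r³ (q_i + q_j)`.
It vanishes identically at `lam = β = 0`, is even in the momenta, odd under the bond reflection
`i ↔ j`, hence has zero mean and zero temperature-derivative in every Gibbs state
(temperature-blind). -/
def umklappXi (ω₂ lam β : ℝ) (N : ℕ) (i j : Fin N) (z : PhaseSpace N) : ℝ :=
  -(3 * β * (z.1 j - z.1 i) ^ 2 * (z.2 i ^ 2 - z.2 j ^ 2))
    - 2 * β * (z.1 j - z.1 i) ^ 2 * (potU ω₂ lam (z.1 j) - potU ω₂ lam (z.1 i))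
    - lam / 2 * (1 + β * (z.1 j - z.1 i) ^ 2) * (z.1 j - z.1 i) ^ 3 * (z.1 i + z.1 j)

/-- FIRST LEMMA of card U (pointwise algebra + one-variable `deriv`s of polynomials; provable now).
For every interior bond `(i, i+1)` (`1 ≤ i`, `i + 2 < N`, so that the generator's bath terms do not
touch `j_i` and both neighbouring bonds exist) and all bath data:
`L (j_i) = ½(Φ_i − Φ_{i+1}) − ½ Ξ_{i,i+1}` pointwise on phase space. -/
def CurrentBalanceIdentity : Prop :=
  ∀ ω₂ lam β γ : ℝ, ∀ (N : ℕ) (T_L T_R : ℝ) (i j : Fin N), j.val = i.val + 1 → 1 ≤ i.val →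
    j.val + 1 < N → ∀ z : PhaseSpace N,
      (pinnedChain ω₂ lam β γ).generator N T_L T_R ((pinnedChain ω₂ lam β γ).bondCurrent N i) z =
        (fluxPhi ω₂ lam β N i z - fluxPhi ω₂ lam β N j z) / 2 - umklappXi ω₂ lam β N i j z / 2

/-- Stationary consequence (every steady state with the three observables integrable and the weak
equation extended from `C_c^∞` to these polynomial observables — CEHR exponential moments):
the `Φ`-profile's interior increments ARE the umklapp-density profile,
`μ(Φ_i) − μ(Φ_{i+1}) = μ(Ξ_{i,i+1})`. Exact at every `T_L, T_R` (not only in linear response). -/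
def StationaryUmklappBalance : Prop :=
  ∀ ω₂ lam β γ : ℝ, 0 < ω₂ → 0 < lam → 0 < β → 0 < γ →
    ∀ (N : ℕ) (T_L T_R : ℝ), 0 < T_L → 0 < T_R →
    ∀ μ : Measure (PhaseSpace N), (pinnedChain ω₂ lam β γ).IsSteadyState N T_L T_R μ →
    (∀ ν : Measure (PhaseSpace N), (pinnedChain ω₂ lam β γ).IsSteadyState N T_L T_R ν → ν = μ) →
    ∀ i j : Fin N, j.val = i.val + 1 → 1 ≤ i.val → j.val + 1 < N →
      (∫ z, fluxPhi ω₂ lam β N i z ∂μ) - (∫ z, fluxPhi ω₂ lam β N j z ∂μ)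
        = ∫ z, umklappXi ω₂ lam β N i j z ∂μ

/-- RESPONSE OF A COBOUNDARY IS A CONTACT EXPECTATION (exact at finite `δ`; provable now from the
weak equation and linearity of the generator in the bath temperatures): for `f ∈ C_c^∞`, the steady
states `μ_δ` at `(T + δ/2, T − δ/2)` and `μ_0` at `(T, T)` satisfy
`(μ_δ(L_{T,T} f) − μ_0(L_{T,T} f))/δ = −(γ/2)·μ_δ(∂²_{p_0} f − ∂²_{p_{N−1}} f)`.
In the limit `δ → 0` (with `μ_0` = Gibbs) the right side is the static contact covariance
`−(γ/2T²)·Cov_T(p_0² − p_{N−1}², f)`, which VANISHES when `f` does not read `p_0, p_{N−1}`: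
the linear response annihilates bulk Liouville coboundaries exactly. -/
def ResponseOfCoboundary : Prop :=
  ∀ ω₂ lam β γ : ℝ, 0 < ω₂ → 0 < lam → 0 < β → 0 < γ →
    ∀ (N : ℕ) (T δ : ℝ), 0 < T → 0 < T + δ / 2 → 0 < T - δ / 2 → δ ≠ 0 →
    ∀ μδ μ0 : Measure (PhaseSpace N),
      (pinnedChain ω₂ lam β γ).IsSteadyState N (T + δ / 2) (T - δ / 2) μδ →
      (pinnedChain ω₂ lam β γ).IsSteadyState N T T μ0 →
      ∀ f : PhaseSpace N → ℝ, ContDiff ℝ (⊤ : ℕ∞) f → HasCompactSupport f →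
        ((∫ z, (pinnedChain ω₂ lam β γ).generator N T T f z ∂μδ)
            - ∫ z, (pinnedChain ω₂ lam β γ).generator N T T f z ∂μ0) / δ =
          -(γ / 2) * ∫ z, ((∑ b : Fin N, if b.val = 0 then partialP b (partialP b f) z else 0)
              - ∑ b : Fin N, if b.val = N - 1 then partialP b (partialP b f) z else 0) ∂μδ

/-- UMKLAPP OHM LAW (the transport half of the transfer; the crux's quantifier frame): the linear
response of the umklapp density of a bulk bond is `rΞ` times the per-bond current response, up to
exponentially small contact layers, uniformly in `N` — "the resistive force density is uniform":
`|Θ_N(Ξ_{i,i+1}) − rΞ·d/(N−1)| ≤ C|d/(N−1)|(θ^i + θ^{N−2−i})`. At `lam = β = 0` it holds with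
`rΞ = 0`, `C = 0`. -/
def UmklappOhm : Prop :=
  ∀ ω₂ lam β γ : ℝ, 0 < ω₂ → 0 < lam → 0 < β → 0 < γ → (∀ (N : ℕ) (T_L T_R : ℝ), 0 < T_L → 0 < T_R → ∀ μ ν : MeasureTheory.Measure (PhaseSpace N), (pinnedChain ω₂ lam β γ).IsSteadyState N T_L T_R μ → (pinnedChain ω₂ lam β γ).IsSteadyState N T_L T_R ν → μ = ν) → ∀ μ : (N : ℕ) → ℝ → ℝ → MeasureTheory.Measure (PhaseSpace N), (∀ (N : ℕ) (T_L T_R : ℝ), 0 < T_L → 0 < T_R → (pinnedChain ω₂ lam β γ).IsSteadyState N T_L T_R (μ N T_L T_R)) → ∀ T : ℝ, 0 < T → ∃ rΞ θ C : ℝ, 0 ≤ θ ∧ θ < 1 ∧ ∀ (N : ℕ) (d : ℝ) (u : Fin N → ℝ), Filter.Tendsto (fun δ : ℝ => (pinnedChain ω₂ lam β γ).totalCurrent (μ N (T + δ / 2) (T - δ / 2)) / δ) (nhdsWithin 0 {(0 : ℝ)}ᶜ) (nhds d) → ∀ i j : Fin N, j.val = i.val + 1 → 1 ≤ i.val → j.val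 + 1 < N → Filter.Tendsto (fun δ : ℝ => ((∫ z, umklappXi ω₂ lam β N i j z ∂(μ N (T + δ / 2) (T - δ / 2))) - ∫ z, umklappXi ω₂ lam β N i j z ∂(μ N T T)) / δ) (nhdsWithin 0 {(0 : ℝ)}ᶜ) (nhds (u i)) → |u i - rΞ * (d / ((N : ℝ) - 1))| ≤ C * |d / ((N : ℝ) - 1)| * (θ ^ i.val + θ ^ (N - 2 - i.val))

/-- THERMOMETER LOCK (the local-equilibrium half): the `Φ`-thermometer and the kinetic thermometer
see the same bulk gradient, `Θ_N(Φ_i − Φ_{i+1}) = χ·Θ_N(p_i² − p_{i+1}²) + O(|d/(N−1)|θ^dist)` with one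
`χ ≠ 0` (`χ = ∂_T⟨Φ⟩_T`, a static susceptibility) independent of `N`. -/
def ThermometerLock : Prop :=
  ∀ ω₂ lam β γ : ℝ, 0 < ω₂ → 0 < lam → 0 < β → 0 < γ → (∀ (N : ℕ) (T_L T_R : ℝ), 0 < T_L → 0 < T_R → ∀ μ ν : MeasureTheory.Measure (PhaseSpace N), (pinnedChain ω₂ lam β γ).IsSteadyState N T_L T_R μ → (pinnedChain ω₂ lam β γ).IsSteadyState N T_L T_R ν → μ = ν) → ∀ μ : (N : ℕ) → ℝ → ℝ → MeasureTheory.Measure (PhaseSpace N), (∀ (N : ℕ) (T_L T_R : ℝ), 0 < T_L → 0 < T_R → (pinnedChain ω₂ lam β γ).IsSteadyState N T_L T_R (μ N T_L T_R)) → ∀ T : ℝ, 0 < T → ∃ χ θ C : ℝ, χ ≠ 0 ∧ 0 ≤ θ ∧ θ < 1 ∧ ∀ (N : ℕ) (d : ℝ) (t tΦ : Fin N → ℝ), Filter.Tendsto (fun δ : ℝ => (pinnedChain ω₂ lam β γ).totalCurrent (μ N (T + δ / 2) (T - δ / 2)) / δ) (nhdsWithin 0 {(0 : ℝ)}ᶜ)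 (nhds d) → (∀ i : Fin N, Filter.Tendsto (fun δ : ℝ => ((∫ z, (z.2 i) ^ 2 ∂(μ N (T + δ / 2) (T - δ / 2))) - ∫ z, (z.2 i) ^ 2 ∂(μ N T T)) / δ) (nhdsWithin 0 {(0 : ℝ)}ᶜ) (nhds (t i))) → (∀ i : Fin N, Filter.Tendsto (fun δ : ℝ => ((∫ z, fluxPhi ω₂ lam β N i z ∂(μ N (T + δ / 2) (T - δ / 2))) - ∫ z, fluxPhi ω₂ lam β N i z ∂(μ N T T)) / δ) (nhdsWithin 0 {(0 : ℝ)}ᶜ) (nhds (tΦ i))) → ∀ i j : Fin N, j.val = i.val + 1 → 1 ≤ i.val → j.val + 1 < N → |(tΦ i - tΦ j) - χ * (t i - t j)| ≤ C * |d / ((N : ℝ) - 1)| * (θ ^ i.val + θ ^ (N - 2 - i.val))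

/-- CONTACT ROWS (depth-one Kapitza bound, the two bonds the interior identity does not cover):
`|t_i ∓ 1/2| ≤ C|d/(N−1)|` for `i ∈ {0,1}` resp. `{N−2,N−1}`. At the bath sites this is the exact
ContactIdentity; at their neighbours it is boundedness of the first contact increment. -/
def ContactRows : Prop :=
  ∀ ω₂ lam β γ : ℝ, 0 < ω₂ → 0 < lam → 0 < β → 0 < γ → (∀ (N : ℕ) (T_L T_R : ℝ), 0 < T_L → 0 < T_R → ∀ μ ν : MeasureTheory.Measure (PhaseSpace N), (pinnedChain ω₂ lam β γ).IsSteadyState N T_L T_R μ → (pinnedChain ω₂ lam β γ).IsSteadyState N T_L T_R ν → μ = ν) → ∀ μ : (N : ℕ) → ℝ → ℝ → MeasureTheory.Measure (PhaseSpace N), (∀ (N : ℕ) (T_L T_R : ℝ), 0 < T_L → 0 < T_R → (pinnedChain ω₂ lam β γ).IsSteadyState N T_L T_R (μ N T_L T_R)) → ∀ T : ℝ, 0 < T → ∃ C : ℝ, ∀ (N : ℕ) (d : ℝ) (t : Fin N → ℝ), 4 ≤ N → Filter.Tendsto (fun δ : ℝ => (pinnedChain ω₂ lam β γ).totalCurrent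 (μ N (T + δ / 2) (T - δ / 2)) / δ) (nhdsWithin 0 {(0 : ℝ)}ᶜ) (nhds d) → (∀ i : Fin N, Filter.Tendsto (fun δ : ℝ => ((∫ z, (z.2 i) ^ 2 ∂(μ N (T + δ / 2) (T - δ / 2))) - ∫ z, (z.2 i) ^ 2 ∂(μ N T T)) / δ) (nhdsWithin 0 {(0 : ℝ)}ᶜ) (nhds (t i))) → ∀ i : Fin N, (i.val ≤ 1 → |t i - 1 / 2| ≤ C * |d / ((N : ℝ) - 1)|) ∧ (N ≤ i.val + 2 → |t i + 1 / 2| ≤ C * |d / ((N : ℝ) - 1)|)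

/-- THE TRANSFER of card U (real analysis once the pieces hold; `r := rΞ/χ`):
`UmklappOhm ∧ ThermometerLock ∧ ContactRows → TwoModeBulk` (via the linear-response form of
`StationaryUmklappBalance`: `tΦ i − tΦ j = u i` on interior bonds). -/
def UmklappTransfer : Prop :=
  StationaryUmklappBalance → UmklappOhm → ThermometerLock → ContactRows →
    Summit.AtomisticToContinuum.FouriersLaw.Theses.PuiseuxTransferLedger.TwoModeBulk

/-! ## Card P — exponentially screened kinetic precision -/

/-- The time-integrated kinetic covariance kernel of the EQUILIBRIUM open chain (both baths at `T`):
`K_N(x, y) = ∫₀^∞ Cov_T(p_x²(0), p_y²(t)) dt`, over the tree's `gibbsMeasure` and `transitionKernel`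
(Bochner integral over `Set.Ioi 0`; junk `0` if not integrable). -/
def kineticKernel (P : OscillatorChain) (N : ℕ) (T : ℝ) (x y : Fin N) : ℝ :=
  ∫ t in Set.Ioi (0 : ℝ),
    ((∫ z, (z.2 x) ^ 2 * (∫ w, (w.2 y) ^ 2 ∂(P.transitionKernel N T T t.toNNReal z)) ∂(P.gibbsMeasure N T))
      - (∫ z, (z.2 x) ^ 2 ∂(P.gibbsMeasure N T)) * (∫ z, (z.2 y) ^ 2 ∂(P.gibbsMeasure N T)))

/-- KILLING IDENTITY (energy conservation; provable from `L H = γ(T − p_0²) + γ(T − p_{N−1}²)` and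
fixed-`N` mixing): `γ·(K_N(0, y) + K_N(N−1, y)) = T²` for every site `y`, `N ≥ 2`. In precision
language: the interior row sums of `K_N⁻¹` vanish identically and the two contact rows leak `γ/T²`. -/
def KillingIdentity : Prop :=
  ∀ ω₂ lam β γ : ℝ, 0 < ω₂ → 0 < lam → 0 < β → 0 < γ → ∀ T : ℝ, 0 < T → ∀ N : ℕ, ∀ hN : 2 ≤ N,
    ∀ y : Fin N,
      γ * (kineticKernel (pinnedChain ω₂ lam β γ) N T ⟨0, by omega⟩ y
        + kineticKernel (pinnedChain ω₂ lam β γ) N T ⟨N - 1, by omega⟩ y) = T ^ 2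

/-- PROFILE = FAR-BATH COLUMN (Kundu–Dhar–Narayan noise-amplitude identity + the equipartition sum
rule, in the crux's frame): the kinetic-temperature response profile of the crux is
`t i = 1/2 − (γ/T²)·K_N(N−1, i)`. -/
def ProfileIsFarColumn : Prop :=
  ∀ ω₂ lam β γ : ℝ, 0 < ω₂ → 0 < lam → 0 < β → 0 < γ → (∀ (N : ℕ) (T_L T_R : ℝ), 0 < T_L → 0 < T_R → ∀ μ ν : MeasureTheory.Measure (PhaseSpace N), (pinnedChain ω₂ lam β γ).IsSteadyState N T_L T_R μ → (pinnedChain ω₂ lam β γ).IsSteadyState N T_L T_R ν → μ = ν) → ∀ μ : (N : ℕ) → ℝ → ℝ → MeasureTheory.Measure (PhaseSpace N), (∀ (N : ℕ) (T_L T_R : ℝ), 0 < T_L → 0 < T_R → (pinnedChain ω₂ lam β γ).IsSteadyState N T_L T_R (μ N T_L T_R)) → ∀ T : ℝ, 0 < T → ∀ (N : ℕ) (hN : 2 ≤ N) (i : Fin N) (ti : ℝ), Filter.Tendsto (fun δ : ℝ => ((∫ z, (z.2 i) ^ 2 ∂(μ N (T + δ / 2) (T - δ / 2))) - ∫ z,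 (z.2 i) ^ 2 ∂(μ N T T)) / δ) (nhdsWithin 0 {(0 : ℝ)}ᶜ) (nhds ti) → ti = 1 / 2 - γ / T ^ 2 * kineticKernel (pinnedChain ω₂ lam β γ) N T ⟨N - 1, by omega⟩ i

/-- FIRST LEMMA of card P (pure algebra of linear recurrences; provable now). PALINDROMIC
RECURRENCE MODES, bandwidth 2: let `a₁ a₂ : ℝ`, `a₂ ≠ 0`, `a₀ := −2a₁ − 2a₂` (zero row sum) and
suppose the symbol `a₂(z² + z⁻²) + a₁(z + z⁻¹) + a₀ = a₂ z⁻²(z − 1)²(z² − s z + 1)`,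
`s = −a₁/a₂ − 2`, is HYPERBOLIC off the double root: `|s| > 2`. Then there is `ζ` with
`0 < |ζ| < 1`, `ζ + ζ⁻¹ = s`, such that every two-sided solution of
`a₂(u(x+2) + u(x−2)) + a₁(u(x+1) + u(x−1)) + a₀ u(x) = 0` is `A + B·x + C·ζ^x + D·ζ^(−x)`:
the Jordan pair (`1, x`) plus one decaying and one growing geometric mode — the two-mode bulk with
layers of rate `θ = |ζ|` once boundary rows select `C` at the left and `D ζ^{−N}` at the right. -/
def PalindromicRecurrenceModes : Prop :=
  ∀ a₁ a₂ : ℝ, a₂ ≠ 0 → 2 < |-(a₁ / a₂) - 2| →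
    ∃ ζ : ℝ, ζ ≠ 0 ∧ |ζ| < 1 ∧ ζ + ζ⁻¹ = -(a₁ / a₂) - 2 ∧
      ∀ u : ℤ → ℝ,
        (∀ x : ℤ, a₂ * (u (x + 2) + u (x - 2)) + a₁ * (u (x + 1) + u (x - 1))
            + (-2 * a₁ - 2 * a₂) * u x = 0) →
        ∃ A B C D : ℝ, ∀ x : ℤ, u x = A + B * x + C * ζ ^ x + D * ζ ^ (-x)

/-- EXPONENTIALLY SCREENED PRECISION (the hypothesis C⁺ of card P): the precision
`P_N = K_N⁻¹` of the kinetic kernel is exponentially localised and exponentially homogeneous —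
there are a symmetric bulk symbol `p : ℤ → ℝ` with `|p d| ≤ C ϑ^|d|` and rate `ϑ < 1` such that
`|P_N(x, y) − p(x − y)| ≤ C ϑ^|x−y| (ϑ^{min(x,y)} + ϑ^{N−1−max(x,y)})` for all `N` and sites. -/
def ExpScreenedPrecision : Prop :=
  ∀ ω₂ lam β γ : ℝ, 0 < ω₂ → 0 < lam → 0 < β → 0 < γ → ∀ T : ℝ, 0 < T →
    ∃ (p : ℤ → ℝ) (ϑ C : ℝ), 0 ≤ ϑ ∧ ϑ < 1 ∧ (∀ d : ℤ, p (-d) = p d) ∧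
      (∀ d : ℤ, |p d| ≤ C * ϑ ^ d.natAbs) ∧
      ∀ N : ℕ, 2 ≤ N → ∀ x y : Fin N,
        |(Matrix.of fun a b : Fin N => kineticKernel (pinnedChain ω₂ lam β γ) N T a b)⁻¹ x y
            - p ((x.val : ℤ) - (y.val : ℤ))|
          ≤ C * ϑ ^ ((x.val : ℤ) - (y.val : ℤ)).natAbs
              * (ϑ ^ min x.val y.val + ϑ ^ (N - 1 - max x.val y.val))

/-- NO UNIMODULAR ROOT besides the double root at `1` (no spatially staggered DC zero mode): the
bulk symbol `p̂(q) = Σ_d p(d) cos(q d)` of `ExpScreenedPrecision` does not vanish for `0 < q ≤ π`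
(automatic when `p` has Laplacian signs; its failure at `q = π` is the `k = π` staggering). Stated
for any candidate symbol `p`. -/
def NoUnimodularRoot (p : ℤ → ℝ) : Prop :=
  ∀ q : ℝ, 0 < q → q ≤ Real.pi → (∑' d : ℤ, p d * Real.cos (q * d)) ≠ 0

/-- THE TRANSFER of card P: screening + no unimodular root (+ the two kernel identities) give the
crux, with `θ` = the largest sub-unimodular root modulus of the symbol and `r` read off the left
contact rows (finite-section Wiener–Hopf). -/
def ScreeningTransfer : Prop :=
  KillingIdentity → ProfileIsFarColumn →
    (∀ ω₂ lam β γ : ℝ, 0 < ω₂ → 0 < lam → 0 < β → 0 < γ → ∀ T : ℝ, 0 < T →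
      ∃ (p : ℤ → ℝ) (ϑ C : ℝ), 0 ≤ ϑ ∧ ϑ < 1 ∧ (∀ d : ℤ, p (-d) = p d) ∧
        (∀ d : ℤ, |p d| ≤ C * ϑ ^ d.natAbs) ∧ NoUnimodularRoot p ∧
        ∀ N : ℕ, 2 ≤ N → ∀ x y : Fin N,
          |(Matrix.of fun a b : Fin N => kineticKernel (pinnedChain ω₂ lam β γ) N T a b)⁻¹ x y
              - p ((x.val : ℤ) - (y.val : ℤ))|
            ≤ C * ϑ ^ ((x.val : ℤ) - (y.val : ℤ)).natAbs
                * (ϑ ^ min x.val y.val + ϑ ^ (N - 1 - max x.val y.val))) →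
    Summit.AtomisticToContinuum.FouriersLaw.Theses.PuiseuxTransferLedger.TwoModeBulk

end Summit.AtomisticToContinuum.FouriersLaw.Cruxes.TwoModeBulk.Ideator1
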